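import Summits.HodgeConjecture.CorCM.GaloisSixteenStructure
import Summits.HodgeConjecture.CorCM.GaloisSixteenTableLawsB
import Summits.HodgeConjecture.CorCM.GaloisSixteenQuaternionCentralProductCensus
import Summits.HodgeConjecture.CorCM.GaloisSixteenDihedralCensus
import Summits.HodgeConjecture.CorCM.GaloisSixteenQuaternionCensus
import Summits.HodgeConjecture.CorCM.GaloisSixteenDihedralProductCensus
import Summits.HodgeConjecture.CorCM.GaloisSixteenQuaternionProductCensus
import Summits.HodgeConjecture.CorCM.AbelianTwoPowerClassification
import HarnessLib

/-!
# Galois CM fields of degree `16`: the GOOD Galois groups — every simple CM eightfold is nondegenerate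

COR-CM (cell `pub-hodgecm2`), binder seat b04 (gen 17), count-neutral claim GALOIS16-COMPLETE, sufficiency half.
KERNEL ONLY: theorems; no definition, no named fact, no `sorry`.  `HC_CM` is neither used nor claimed.

**THEOREM (`isNondegenerate_of_isPrimitive_of_good16`).**  Let `K` be a Galois CM field of degree `16`,
`G = Gal(K/ℚ)`, `c` complex conjugation.  If
`GOOD16(G,c)`: either every `g ∈ G` satisfies `g² ∈ {1, c}`, or `G` has an element `r` of order `8` with `r⁴ = c` all of
whose conjugates lie in `{r, r⁻¹}`,
then EVERY PRIMITIVE CM type of `K` is NONDEGENERATE; hence (`hodgeConjectureFor_pow_of_isSimple_of_good16`) the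
Hodge conjecture holds for every power of every simple abelian eightfold with complex multiplication by `K`,
unconditionally.  The good pairs `(G, c)` are `C₁₆`, `C₈ × C₂` (`c = (4,0)`), `C₂⁴`, `C₄ × C₂²` (`c` a square),
`D₄ × C₂` (`c = r²`), `Q₈ × C₂` (`c = a²`), the Pauli group `C₄ ∘ D₄`, `D₁₆`, `Q₁₆`.

Assembly: commutative `G` — gen 16's `AbelianTwoPowerClassification.isNondegenerate_of_isPrimitive_of_good`;
squares in `{1, c}`, non-commutative — `GaloisSixteenStructure.structure_of_sq_subset` + the law-C tables
(`exists_table_d4c2 / q8c2 / lawC (2,2)`) + the censuses (gen 16's `D₄ × C₂`, `Q₈ × C₂` over Mathlib's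
`DihedralGroup 4`, `QuaternionGroup 2` through decided bridges; `GaloisSixteenQuaternionCentralProductCensus` for
`C₄ ∘ D₄ ≅ Q₈ ∘ C₄`, the presentation `y² = 1, t² = x²` being first normalised to `y² = t² = x²` by `y ↦ y t`,
`normalise_pauli`); an element of order `8` with conjugates in `{r, r⁻¹}` —
`structure_of_orderOf_eq_eight` + `exists_table_d16 / q16` + gen 16's `D₁₆`, `Q₁₆` censuses through decided bridges.

## References

* [Dodson1984] B. Dodson, *The structure of Galois groups of CM-fields*, Trans. AMS 283 (1984), §3.3, §5.3.1.
* [Dodson1987] B. Dodson, J. Algebra 111 (1987), §1.1 p. 50.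
* [Shimura1998] G. Shimura, *Abelian Varieties with Complex Multiplication and Modular Functions*, §8.2 Prop. 26.
* [Gordon1999HodgeAVSurvey] B. B. Gordon, *A survey of the Hodge conjecture for abelian varieties*, Thm. 6.4.
-/

noncomputable section

open CategoryTheory CategoryTheory.Limits NumberField

namespace Summit.HodgeConjecture.CorCM.GaloisSixteenClassification

open Literature.NumberTheory.ComplexMultiplication
open Literature.AlgebraicGeometry.Motives (AbelianVariety CMType)
open Literature.AlgebraicGeometry.HodgeTheory
open Literature.AlgebraicGeometry.ComplexMultiplication (IsCMTypeRealisation isSimple_iff_isPrimitive)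
open Literature.AlgebraicGeometry.Pohlmann1968
open Summit.HodgeConjecture.CorCM.GaloisTableLaws
open Summit.HodgeConjecture.CorCM.GaloisSixteenStructure

open scoped Classical

variable {K : Type} [Field K] [NumberField K] [IsCMField K] [IsGalois ℚ K]

/-! ## §1 The Galois group of a Galois CM field of degree `16` -/

/-- `|Gal(K/ℚ)| = 16`, and complex conjugation is a central involution `≠ 1`. [cite: Shimura1998, §18.2 Lemma (i)] -/
theorem gal_facts (hK : Module.finrank ℚ K = 16) :
    Nat.card (K ≃ₐ[ℚ] K) = 16 ∧ (IsCMField.complexConj K).restrictScalars ℚ ≠ 1 ∧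
      (IsCMField.complexConj K).restrictScalars ℚ * (IsCMField.complexConj K).restrictScalars ℚ = 1 ∧
      ∀ g : K ≃ₐ[ℚ] K, g * (IsCMField.complexConj K).restrictScalars ℚ = (IsCMField.complexConj K).restrictScalars ℚ * g :=
  ⟨by rw [IsGalois.card_aut_eq_finrank, hK], GaloisOctic.complexConj_restrictScalars_ne_one,
    GaloisOctic.complexConj_mul_self, fun g => (GaloisOctic.complexConj_mul_comm g).symm⟩

/-- **Normalising the Pauli presentation**: from `y² = 1`, `t² = x²` (`t` central) pass to `y' = y t` with
`y'² = t² = x²` (law C `(2,2)`), keeping all the hypotheses of `exists_table_lawC`. [folklore] -/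
theorem normalise_pauli {G : Type*} [Group G] [Finite G] (x y t : G) (hx : orderOf x = 4) (hy : y ∉ Subgroup.zpowers x)
    (ht : ∀ i j : ℕ, x ^ i * y ^ j * t ≠ 1) (hyx : y * x = x ^ 3 * y) (hyy : y * y = 1) (htx : t * x = x * t)
    (hty : t * y = y * t) (htt : t * t = x ^ 2) :
    (y * t) ∉ Subgroup.zpowers x ∧ (∀ i j : ℕ, x ^ i * (y * t) ^ j * t ≠ 1) ∧ (y * t) * x = x ^ 3 * (y * t) ∧
      (y * t) * (y * t) = x ^ 2 ∧ t * (y * t) = (y * t) * t := by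
  have hx4 : x ^ 4 = 1 := by rw [← hx]; exact pow_orderOf_eq_one x
  have hyt : Commute y t := hty.symm
  refine ⟨fun hmem => ?_, fun i j h => ?_, ?_, ?_, ?_⟩
  · obtain ⟨k, -, hk⟩ := exists_pow_lt_of_mem_zpowers hmem
    refine ht (3 * k) 1 ?_
    rw [pow_one, mul_assoc, hk, ← pow_add, pow_eq_pow_of_mod_eq x hx4 (a := 3 * k + k) (b := 0) (by omega),
      pow_zero]
  · -- `xⁱ (y t)ʲ t = xⁱ yʲ t^{j+1} = x^{i + 3ʲ·2q} yʲ t^ρ` with `j + 1 = 2q + ρ`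
    rw [hyt.mul_pow, mul_assoc (x ^ i), mul_assoc (y ^ j), ← pow_succ] at h
    have hsplit : t ^ (j + 1) = x ^ (2 * ((j + 1) / 2)) * t ^ ((j + 1) % 2) := by
      conv_lhs => rw [← Nat.div_add_mod (j + 1) 2]
      rw [pow_add, pow_mul, pow_two, htt, ← pow_mul]
    rw [hsplit, ← mul_assoc (y ^ j), pow_mul_pow_of_yx x y hyx j, ← mul_assoc, ← mul_assoc, ← pow_add] at h
    rcases Nat.mod_two_eq_zero_or_one (j + 1) with hρ | hρ
    · -- `j` odd: `yʲ = y ∈ ⟨x⟩`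
      rw [hρ, pow_zero, mul_one] at h
      have hjodd : j % 2 = 1 := by omega
      have hyj : y ^ j = y := by
        conv_lhs => rw [← Nat.div_add_mod j 2]
        rw [pow_add, pow_mul, pow_two, hyy, one_pow, one_mul, hjodd, pow_one]
      rw [hyj] at h
      apply hy
      rw [eq_inv_of_mul_eq_one_right h]
      exact Subgroup.inv_mem _ (Subgroup.pow_mem _ (Subgroup.mem_zpowers x) _)
    · rw [hρ, pow_one] at h
      exact ht _ _ h
  · rw [mul_assoc, htx, ← mul_assoc, hyx, mul_assoc]
  · calc y * t * (y * t) = y * (t * y) * t := by group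
      _ = y * (y * t) * t := by rw [hty]
      _ = (y * y) * (t * t) := by group
      _ = x ^ 2 := by rw [hyy, one_mul, htt]
  · rw [← mul_assoc, hty]

/-! ## §2 Decided bridges from the law-A / law-C tables to Mathlib's concrete groups -/

/-- Bridge: table law `(7,0)` ⟶ `DihedralGroup 8`, `(i,0) ↦ r i`, `(i,1) ↦ sr (-i)`. [folklore] -/
theorem bridge_d16 : (∀ p q : ZMod 8 × ZMod 2,
    (fun p : ZMod 8 × ZMod 2 => if p.2 = 0 then DihedralGroup.r p.1 else DihedralGroup.sr (-p.1))
      ((fun p q : ZMod 8 × ZMod 2 => (p.1 + (if p.2 = 0 then q.1 else 7 * q.1), p.2 + q.2)) p q) =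
    (fun p : ZMod 8 × ZMod 2 => if p.2 = 0 then DihedralGroup.r p.1 else DihedralGroup.sr (-p.1)) p *
    (fun p : ZMod 8 × ZMod 2 => if p.2 = 0 then DihedralGroup.r p.1 else DihedralGroup.sr (-p.1)) q) ∧
    Function.Bijective
      (fun p : ZMod 8 × ZMod 2 => if p.2 = 0 then DihedralGroup.r (n := 8) p.1 else DihedralGroup.sr (-p.1)) := by
  constructor <;> decide

/-- Bridge: table law `(7,4)` ⟶ `QuaternionGroup 4`, `(i,0) ↦ a i`, `(i,1) ↦ xa (-i)`. [folklore] -/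
theorem bridge_q16 : (∀ p q : ZMod 8 × ZMod 2,
    (fun p : ZMod 8 × ZMod 2 => if p.2 = 0 then QuaternionGroup.a (n := 4) p.1 else QuaternionGroup.xa (-p.1))
      ((fun p q : ZMod 8 × ZMod 2 => (p.1 + (if p.2 = 0 then q.1 else 7 * q.1 + (if q.2 = 0 then 0 else 4)),
        p.2 + q.2)) p q) =
    (fun p : ZMod 8 × ZMod 2 => if p.2 = 0 then QuaternionGroup.a (n := 4) p.1 else QuaternionGroup.xa (-p.1)) p *
    (fun p : ZMod 8 × ZMod 2 => if p.2 = 0 then QuaternionGroup.a (n := 4) p.1 else QuaternionGroup.xa (-p.1)) q) ∧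
    Function.Bijective
      (fun p : ZMod 8 × ZMod 2 => if p.2 = 0 then QuaternionGroup.a (n := 4) p.1 else QuaternionGroup.xa (-p.1)) := by
  constructor <;> decide

/-- Bridge: table law C `(0,0)` ⟶ `DihedralGroup 4 × Multiplicative (ZMod 2)`. [folklore] -/
theorem bridge_d4c2 : (∀ p q : ZMod 4 × ZMod 2 × ZMod 2,
    (fun p : ZMod 4 × ZMod 2 × ZMod 2 => ((if p.2.1 = 0 then DihedralGroup.r (n := 4) p.1 else DihedralGroup.sr (-p.1)),
      Multiplicative.ofAdd p.2.2))
      ((fun p q : ZMod 4 × ZMod 2 × ZMod 2 => (p.1 + (if p.2.1 = 0 then q.1 else 3 * q.1), p.2.1 + q.2.1,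
        p.2.2 + q.2.2)) p q) =
    (fun p : ZMod 4 × ZMod 2 × ZMod 2 => ((if p.2.1 = 0 then DihedralGroup.r (n := 4) p.1 else DihedralGroup.sr (-p.1)),
      Multiplicative.ofAdd p.2.2)) p *
    (fun p : ZMod 4 × ZMod 2 × ZMod 2 => ((if p.2.1 = 0 then DihedralGroup.r (n := 4) p.1 else DihedralGroup.sr (-p.1)),
      Multiplicative.ofAdd p.2.2)) q) ∧
    Function.Bijective (fun p : ZMod 4 × ZMod 2 × ZMod 2 =>
      ((if p.2.1 = 0 then DihedralGroup.r (n := 4) p.1 else DihedralGroup.sr (-p.1)), Multiplicative.ofAdd p.2.2)) := by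
  constructor <;> decide

/-- Bridge: table law C `(2,0)` ⟶ `QuaternionGroup 2 × Multiplicative (ZMod 2)`. [folklore] -/
theorem bridge_q8c2 : (∀ p q : ZMod 4 × ZMod 2 × ZMod 2,
    (fun p : ZMod 4 × ZMod 2 × ZMod 2 => ((if p.2.1 = 0 then QuaternionGroup.a (n := 2) p.1 else QuaternionGroup.xa (-p.1)),
      Multiplicative.ofAdd p.2.2))
      ((fun p q : ZMod 4 × ZMod 2 × ZMod 2 => (p.1 + (if p.2.1 = 0 then q.1 else 3 * q.1) +
        (if p.2.1 = 1 ∧ q.2.1 = 1 then 2 else 0), p.2.1 + q.2.1, p.2.2 + q.2.2)) p q) =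
    (fun p : ZMod 4 × ZMod 2 × ZMod 2 => ((if p.2.1 = 0 then QuaternionGroup.a (n := 2) p.1 else QuaternionGroup.xa (-p.1)),
      Multiplicative.ofAdd p.2.2)) p *
    (fun p : ZMod 4 × ZMod 2 × ZMod 2 => ((if p.2.1 = 0 then QuaternionGroup.a (n := 2) p.1 else QuaternionGroup.xa (-p.1)),
      Multiplicative.ofAdd p.2.2)) q) ∧
    Function.Bijective (fun p : ZMod 4 × ZMod 2 × ZMod 2 =>
      ((if p.2.1 = 0 then QuaternionGroup.a (n := 2) p.1 else QuaternionGroup.xa (-p.1)), Multiplicative.ofAdd p.2.2)) := by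
  constructor <;> decide

/-! ## §3 Sufficiency: `GOOD16` ⟹ every primitive CM type is nondegenerate -/

/-- **`GOOD16(Gal(K/ℚ), c)` ⟹ every PRIMITIVE CM type of the Galois CM field `K` of degree `16` is NONDEGENERATE.**
[cite: Dodson1987, §1.1 (p. 50)] [cite: Shimura1998, §8.2 Prop. 26] -/
theorem isNondegenerate_of_isPrimitive_of_good16 (hK : Module.finrank ℚ K = 16)
    (hgood : (∀ g : K ≃ₐ[ℚ] K, g * g = 1 ∨ g * g = (IsCMField.complexConj K).restrictScalars ℚ) ∨
      (∃ r : K ≃ₐ[ℚ] K, orderOf r = 8 ∧ r ^ 4 = (IsCMField.complexConj K).restrictScalars ℚ ∧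
        ∀ g : K ≃ₐ[ℚ] K, g * r * g⁻¹ = r ∨ g * r * g⁻¹ = r⁻¹))
    {Φ : CMType K} (φ₀ : K →+* ℂ) (hprim : IsPrimitive (ℂ ≃+* ℂ) Φ.1 φ₀) : IsNondegenerate Φ := by
  obtain ⟨hcard, hc1, hcc, hcz⟩ := gal_facts hK
  set c : K ≃ₐ[ℚ] K := (IsCMField.complexConj K).restrictScalars ℚ with hc_def
  by_cases hcomm : ∀ a b : K ≃ₐ[ℚ] K, a * b = b * a
  · -- commutative Galois group: gen 16's classification, cases (γ) resp. (α)
    refine AbelianTwoPowerClassification.isNondegenerate_of_isPrimitive_of_good hcomm (n := 3)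
      (by rw [hK]; norm_num) ?_ φ₀ hprim
    rcases hgood with hsq | ⟨r, hr, hr4, -⟩
    · exact Or.inr (Or.inr ⟨hK, hsq⟩)
    · refine Or.inl ⟨r, ?_, ?_⟩
      · have h4mem : r ^ 4 ∈ Subgroup.zpowers r := Subgroup.pow_mem _ (Subgroup.mem_zpowers r) 4
        rw [hr4] at h4mem
        exact h4mem
      · have h := (Subgroup.zpowers r).index_mul_card
        rw [Nat.card_zpowers, hr, hcard] at h
        omega
  -- non-commutative Galois group
  simp only [not_forall] at hcomm
  obtain ⟨a, b, hab⟩ := hcomm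
  rcases hgood with hsq | ⟨r, hr, hr4, hconj⟩
  · -- all squares in `{1, c}`: law C
    obtain ⟨x, y, t, hx, hxx, hy, ht, hyx, hysq, htx, hty, htsq⟩ :=
      structure_of_sq_subset hcard c hc1 hcz hsq a b hab
    rcases hysq with hyy | hyy <;> rcases htsq with htt | htt
    · -- `D₄ × C₂`, `c = x²`
      obtain ⟨e, hmul, hex, -, -, -⟩ := exists_table_d4c2 x y t hx hy ht hyx hyy htx hty htt hcard
      obtain ⟨e', he'⟩ := exists_mulEquiv_of_table
        (fun p q : ZMod 4 × ZMod 2 × ZMod 2 => (p.1 + (if p.2.1 = 0 then q.1 else 3 * q.1), p.2.1 + q.2.1,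
          p.2.2 + q.2.2)) e hmul _ bridge_d4c2.1 bridge_d4c2.2
      have hc' : e' c = (DihedralGroup.r 2, Multiplicative.ofAdd 0) := by
        rw [he', ← hxx, hmul, hex]; decide
      exact GaloisSixteenDihedralProduct.isNondegenerate_d4c2 e' hc' φ₀ hprim
    · -- Pauli group `C₄ ∘ D₄`: normalise to law C `(2,2)` (`y ↦ y t`)
      obtain ⟨hy', ht', hyx', hyy', hty'⟩ := normalise_pauli x y t hx hy ht hyx hyy htx hty htt
      obtain ⟨e, hmul, hex, -, -, he1⟩ := exists_table_lawC x (y * t) t 2 2 hx hy' ht' hyx' hyy' htx hty' htt hcard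
        (fun p q : ZMod 4 × ZMod 2 × ZMod 2 => (p.1 + (if p.2.1 = 0 then q.1 else 3 * q.1) +
          (if p.2.1 = 1 ∧ q.2.1 = 1 then 2 else 0) + (if p.2.2 = 1 ∧ q.2.2 = 1 then 2 else 0), p.2.1 + q.2.1,
          p.2.2 + q.2.2)) (by decide) (by decide) (by decide)
      have hc' : e c = (2, 0, 0) := by rw [← hxx, hmul, hex]; decide
      exact GaloisSixteenCensus.isNondegenerate_q8c4 e hmul hc' he1 φ₀ hprim
    · -- `Q₈ × C₂`, `c = x²`
      obtain ⟨e, hmul, hex, -, -, -⟩ := exists_table_q8c2 x y t hx hy ht hyx hyy htx hty htt hcard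
      obtain ⟨e', he'⟩ := exists_mulEquiv_of_table
        (fun p q : ZMod 4 × ZMod 2 × ZMod 2 => (p.1 + (if p.2.1 = 0 then q.1 else 3 * q.1) +
          (if p.2.1 = 1 ∧ q.2.1 = 1 then 2 else 0), p.2.1 + q.2.1, p.2.2 + q.2.2)) e hmul _ bridge_q8c2.1 bridge_q8c2.2
      have hc' : e' c = (QuaternionGroup.a 2, Multiplicative.ofAdd 0) := by
        rw [he', ← hxx, hmul, hex]; decide
      exact GaloisSixteenQuaternionProduct.isNondegenerate_q8c2 e' hc' φ₀ hprim
    · -- `Q₈ ∘ C₄` (law C `(2,2)`)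
      obtain ⟨e, hmul, hex, -, -, he1⟩ := exists_table_lawC x y t 2 2 hx hy ht hyx hyy htx hty htt hcard
        (fun p q : ZMod 4 × ZMod 2 × ZMod 2 => (p.1 + (if p.2.1 = 0 then q.1 else 3 * q.1) +
          (if p.2.1 = 1 ∧ q.2.1 = 1 then 2 else 0) + (if p.2.2 = 1 ∧ q.2.2 = 1 then 2 else 0), p.2.1 + q.2.1,
          p.2.2 + q.2.2)) (by decide) (by decide) (by decide)
      have hc' : e c = (2, 0, 0) := by rw [← hxx, hmul, hex]; decide
      exact GaloisSixteenCensus.isNondegenerate_q8c4 e hmul hc' he1 φ₀ hprim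
  · -- an element `r` of order `8` with `r⁴ = c` and conjugates in `{r, r⁻¹}`
    have hr8 : r ^ 8 = 1 := by rw [← hr]; exact pow_orderOf_eq_one r
    obtain ⟨s, hs⟩ : ∃ s : K ≃ₐ[ℚ] K, s ∉ Subgroup.zpowers r := by
      by_contra hall
      simp only [not_exists, not_not] at hall
      have htop : Subgroup.zpowers r = ⊤ := (Subgroup.eq_top_iff' _).2 hall
      have h := Nat.card_zpowers r
      rw [htop, Subgroup.card_top, hcard, hr] at h
      norm_num at h
    obtain ⟨-, μ, τ, -, hτ, hsr, hss, -, hμτ⟩ := structure_of_orderOf_eq_eight hcard r s hr hs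
    rcases hconj s with h | h
    · exact absurd (comm_of_orderOf_eq_eight hcard r s hr hs (by rwa [mul_inv_eq_iff_eq_mul] at h))
        (fun hall => hab (hall a b))
    · have hsr7 : s * r = r ^ 7 * s := by
        rw [mul_inv_eq_iff_eq_mul] at h
        rw [h, inv_eq_of_mul_eq_one_right (show r * r ^ 7 = 1 by rw [← pow_succ', hr8])]
      have hμ7 : μ % 8 = 7 := by
        have h1 : r ^ μ = r ^ 7 := mul_right_cancel (hsr.symm.trans hsr7)
        rwa [pow_inj_mod, hr] at h1
      have hτ04 : τ = 0 ∨ τ = 4 := by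
        have h2 : μ % 8 * (τ % 8) % 8 = τ := by rw [← Nat.mul_mod]; exact hμτ
        rw [hμ7] at h2
        omega
      rcases hτ04 with rfl | rfl
      · -- `D₁₆`
        rw [pow_zero] at hss
        obtain ⟨e, hmul, her, -, -⟩ := exists_table_d16 r s hr hs hsr7 hss hcard
        obtain ⟨e', he'⟩ := exists_mulEquiv_of_table
          (fun p q : ZMod 8 × ZMod 2 => (p.1 + (if p.2 = 0 then q.1 else 7 * q.1), p.2 + q.2)) e hmul _ bridge_d16.1 bridge_d16.2
        have h2 : e (r * r) = (2, 0) := by rw [hmul, her]; decide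
        have hc' : e' c = DihedralGroup.r 4 := by
          rw [he', ← hr4, show r ^ 4 = (r * r) * (r * r) by rw [show (4 : ℕ) = 2 + 2 by norm_num, pow_add, pow_two],
            hmul, h2]; decide
        exact GaloisSixteenDihedral.isNondegenerate_d16 e' hc' φ₀ hprim
      · -- `Q₁₆`
        obtain ⟨e, hmul, her, -, -⟩ := exists_table_q16 r s hr hs hsr7 hss hcard
        obtain ⟨e', he'⟩ := exists_mulEquiv_of_table
          (fun p q : ZMod 8 × ZMod 2 => (p.1 + (if p.2 = 0 then q.1 else 7 * q.1 + (if q.2 = 0 then 0 else 4)),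
          p.2 + q.2)) e hmul _ bridge_q16.1 bridge_q16.2
        have h2 : e (r * r) = (2, 0) := by rw [hmul, her]; decide
        have hc' : e' c = QuaternionGroup.a 4 := by
          rw [he', ← hr4, show r ^ 4 = (r * r) * (r * r) by rw [show (4 : ℕ) = 2 + 2 by norm_num, pow_add, pow_two],
            hmul, h2]; decide
        exact GaloisSixteenQuaternion.isNondegenerate_q16 e' hc' φ₀ hprim

/-! ## §4 Consumers: the Hodge conjecture for all powers of all simple CM eightfolds in the good case -/

section Geometry

variable {Φ : CMType K} {A : AbelianVariety ℂ} {ι : 𝓞 K →+* End A} {θ : K →+* Module.End ℂ (complexBetti A.X 1)}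

/-- **THE HODGE CONJECTURE FOR EVERY POWER OF EVERY SIMPLE ABELIAN EIGHTFOLD WITH COMPLEX MULTIPLICATION BY A GALOIS
CM FIELD OF DEGREE `16` WHOSE GALOIS GROUP SATISFIES `GOOD16`** — unconditionally.
[cite: Gordon1999HodgeAVSurvey, 5.13 (i) and Thm. 6.4] [cite: Shimura1998, §8.2 Prop. 26] -/
theorem hodgeConjectureFor_pow_of_isSimple_of_good16 (hK : Module.finrank ℚ K = 16)
    (hgood : (∀ g : K ≃ₐ[ℚ] K, g * g = 1 ∨ g * g = (IsCMField.complexConj K).restrictScalars ℚ) ∨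
      (∃ r : K ≃ₐ[ℚ] K, orderOf r = 8 ∧ r ^ 4 = (IsCMField.complexConj K).restrictScalars ℚ ∧
        ∀ g : K ≃ₐ[ℚ] K, g * r * g⁻¹ = r ∨ g * r * g⁻¹ = r⁻¹))
    (hA : IsCMTypeRealisation Φ A ι θ) (hs : A.IsSimple) (N : ℕ) :
    HodgeConjectureFor (⨁ fun _ : Fin N => A).dim (⨁ fun _ : Fin N => A).X := by
  obtain ⟨φ₀⟩ := (inferInstance : Nonempty (K →+* ℂ))
  exact (isNondegenerate_of_isPrimitive_of_good16 hK hgood φ₀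
    ((isSimple_iff_isPrimitive hA φ₀).1 hs)).hodgeConjectureFor_pow hA N

/-- The Hodge conjecture for the simple eightfold itself. [cite: Gordon1999HodgeAVSurvey, 5.13 (i)] -/
theorem hodgeConjectureFor_of_isSimple_of_good16 (hK : Module.finrank ℚ K = 16)
    (hgood : (∀ g : K ≃ₐ[ℚ] K, g * g = 1 ∨ g * g = (IsCMField.complexConj K).restrictScalars ℚ) ∨
      (∃ r : K ≃ₐ[ℚ] K, orderOf r = 8 ∧ r ^ 4 = (IsCMField.complexConj K).restrictScalars ℚ ∧
        ∀ g : K ≃ₐ[ℚ] K, g * r * g⁻¹ = r ∨ g * r * g⁻¹ = r⁻¹))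
    (hA : IsCMTypeRealisation Φ A ι θ) (hs : A.IsSimple) : HodgeConjectureFor A.dim A.X := by
  obtain ⟨φ₀⟩ := (inferInstance : Nonempty (K →+* ℂ))
  exact (isNondegenerate_of_isPrimitive_of_good16 hK hgood φ₀
    ((isSimple_iff_isPrimitive hA φ₀).1 hs)).hodgeConjectureFor hA

end Geometry

end Summit.HodgeConjecture.CorCM.GaloisSixteenClassification

end
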